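import Summits.QuantumFields.YangMills.Theorems.LuscherReductionOneSiteLevelsKacInner

/-!
# INNER, flat lane support (III.3 prep): block reflections of `ZM = (ℝ³)³` and Gaussian moment bounds for the heat kernel

Support module of crux `OneSiteLevels` (route `LuscherReduction`, item stmt-QuantumFields-20007; STUB-PLAN
`Cruxes/OneSiteLevels/STUB-PLAN-stub_absUpperInnerAL1.md` §2.2 item III.3 `potential_heatSmooth_le`, the potential-smoothing step of
the FLAT lane `stub_flatKacAL1`), fleet seat ym-luscher-20007-p2 (taken off the flat seat's path per INNER-RULING-g16 «third seat: III.3»).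
Everything here is proved; pure real analysis on `ZM`.

* §1 `blockFlip i : ZM ≃ₗᵢ[ℝ] ZM` — negate the colour vector of block `i` (`z_i ↦ −z_i`, other blocks fixed): a linear isometric
  involution; `colourVec_blockFlip_self/_ne`; `integral_comp_blockFlip` (Lebesgue measure is preserved); `heatKer₀_blockFlip`;
  **`integral_eq_zero_of_blockFlip_odd`**: `∫ F = 0` whenever `F ∘ blockFlip i = −F` (no integrability needed).
* §2 Gaussian moment bounds for `p_t(z) = heatKer₀ t z = (√(2πt)⁹)⁻¹e^{−‖z‖²/(2t)}` with SLOPPY absolute constants (only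
  `GaussForm.integral_exp_neg_mul_sq_norm` and `u e^{−au} ≤ (ea)⁻¹` are used):
  `integral_heatKer₀` (`= 1`), `normSq_mul_heatKer₀_le` / `integral_normSq_mul_heatKer₀_le` (`∫ ‖z‖² p_t ≤ 35 t`),
  `integral_norm_pow_four_mul_heatKer₀_le` (`∫ ‖z‖⁴ p_t ≤ 200 t²`), with the integrability of `‖z‖^{2k} p_t`, `k ≤ 2`.

## WHAT THIS IS NOT
Not III.3 itself (companion file `…KacPotSmooth`); femto rung R2b1 vocabulary; NOT an infinite-volume ∕ Clay gap statement.
-/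

set_option autoImplicit false

noncomputable section

open MeasureTheory Filter Topology Real
open Literature.MathematicalPhysics.QuantumFieldTheory
open Literature.MathematicalPhysics.QuantumLattice
open Literature.Analysis.OperatorTheory.YMMatrixModel

namespace Summit.QuantumFields.YangMills.Theorems.FemtoTransferGap

/-! ### §1. Block reflections -/

/-- The raw block reflection: negate the colour vector of block `i`. [folklore] -/
def blockFlipFun (i : Fin 3) (z : ZM) : ZM := WithLp.toLp 2 fun p : Fin 3 × Fin 3 => if p.1 = i then -z p else z p

/-- Coordinates of the block reflection. [folklore] -/
@[simp] theorem blockFlipFun_apply (i : Fin 3) (z : ZM) (p : Fin 3 × Fin 3) :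
    blockFlipFun i z p = if p.1 = i then -z p else z p := rfl

/-- The block reflection is an involution. [folklore] -/
theorem blockFlipFun_blockFlipFun (i : Fin 3) (z : ZM) : blockFlipFun i (blockFlipFun i z) = z := by
  ext p
  simp only [blockFlipFun_apply]
  split_ifs <;> simp

/-- The block reflection preserves the norm. [folklore] -/
theorem norm_blockFlipFun (i : Fin 3) (z : ZM) : ‖blockFlipFun i z‖ = ‖z‖ := by
  have h : ‖blockFlipFun i z‖ ^ 2 = ‖z‖ ^ 2 := by
    rw [EuclideanSpace.real_norm_sq_eq, EuclideanSpace.real_norm_sq_eq]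
    refine Finset.sum_congr rfl fun p _ => ?_
    rw [blockFlipFun_apply]
    split_ifs <;> simp
  exact (sq_eq_sq₀ (norm_nonneg _) (norm_nonneg _)).1 h

/-- **The block reflection as a linear isometric equivalence of `ZM`.** [folklore] -/
def blockFlip (i : Fin 3) : ZM ≃ₗᵢ[ℝ] ZM where
  toFun := blockFlipFun i
  invFun := blockFlipFun i
  map_add' y z := by
    ext p
    simp only [blockFlipFun_apply, PiLp.add_apply]
    split_ifs <;> ring
  map_smul' c z := by
    ext p
    simp only [blockFlipFun_apply, PiLp.smul_apply, smul_eq_mul, RingHom.id_apply]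
    split_ifs <;> ring
  left_inv := blockFlipFun_blockFlipFun i
  right_inv := blockFlipFun_blockFlipFun i
  norm_map' := norm_blockFlipFun i

/-- `blockFlip i z = blockFlipFun i z`. [folklore] -/
@[simp] theorem blockFlip_apply (i : Fin 3) (z : ZM) : blockFlip i z = blockFlipFun i z := rfl

/-- The reflected block: `(blockFlip i z)_i = −z_i`. [folklore] -/
theorem colourVec_blockFlip_self (i : Fin 3) (z : ZM) : colourVec (blockFlip i z) i = -colourVec z i := by
  funext a; simp [colourVec]

/-- The other blocks are fixed: `(blockFlip i z)_j = z_j` for `j ≠ i`. [folklore] -/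
theorem colourVec_blockFlip_ne {i j : Fin 3} (h : j ≠ i) (z : ZM) : colourVec (blockFlip i z) j = colourVec z j := by
  funext a; simp [colourVec, h]

/-- **Lebesgue measure on `ZM` is invariant under the block reflection**: `∫ F(blockFlip i z) dz = ∫ F`. [folklore] -/
theorem integral_comp_blockFlip (i : Fin 3) (F : ZM → ℝ) : ∫ z, F (blockFlip i z) = ∫ z, F z :=
  (blockFlip i).measurePreserving.integral_comp (blockFlip i).toHomeomorph.measurableEmbedding F

/-- The heat kernel is invariant under block reflections. [folklore] -/
theorem heatKer₀_blockFlip (t : ℝ) (i : Fin 3) (z : ZM) : heatKer₀ t (blockFlip i z) = heatKer₀ t z := by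
  rw [heatKer₀, heatKer₀, LinearIsometryEquiv.norm_map]

/-- **Odd functions integrate to zero**: if `F (blockFlip i z) = −F z` for all `z` then `∫ F = 0` (Bochner: no integrability
hypothesis is needed). [folklore] -/
theorem integral_eq_zero_of_blockFlip_odd {i : Fin 3} {F : ZM → ℝ} (hodd : ∀ z, F (blockFlip i z) = -F z) : ∫ z, F z = 0 := by
  have h := integral_comp_blockFlip i F
  simp only [hodd, integral_neg] at h
  linarith

/-! ### §2. Gaussian moment bounds for the heat kernel `p_t` -/

/-- `∫ p_t = 1` in the difference variable (`t > 0`). [folklore] -/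
theorem integral_heatKer₀ {t : ℝ} (ht : 0 < t) : ∫ z, heatKer₀ t z = 1 := by
  have hπ := Real.pi_pos
  have hb : 0 < 1 / (2 * t) := by positivity
  have hS : 0 < Real.sqrt (2 * π * t) ^ 9 := by positivity
  have hcard : Fintype.card (Fin 3 × Fin 3) = 9 := by simp
  have e : ∀ z : ZM, heatKer₀ t z = (Real.sqrt (2 * π * t) ^ 9)⁻¹ * Real.exp (-(1 / (2 * t)) * ‖z‖ ^ 2) := fun z => by
    rw [heatKer₀]; congr 2; ring
  simp_rw [e]
  rw [integral_const_mul, GaussForm.integral_exp_neg_mul_sq_norm hb, hcard,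
    show π / (1 / (2 * t)) = 2 * π * t by field_simp, inv_mul_cancel₀ hS.ne']

/-- `p_t` is integrable (`t > 0`). [folklore] -/
theorem integrable_heatKer₀ {t : ℝ} (ht : 0 < t) : Integrable (heatKer₀ t) := by
  refine Integrable.of_integral_ne_zero ?_
  rw [integral_heatKer₀ ht]; exact one_ne_zero

/-- The Gaussian factorisation `e^{−‖z‖²/(2t)} = e^{−‖z‖²/(4t)} · e^{−(1/(4t))‖z‖²}`. [folklore] -/
theorem exp_neg_normSq_div_eq {t : ℝ} (ht : 0 < t) (z : ZM) :
    Real.exp (-‖z‖ ^ 2 / (2 * t)) = Real.exp (-(1 / (4 * t)) * ‖z‖ ^ 2) * Real.exp (-(1 / (4 * t)) * ‖z‖ ^ 2) := by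
  rw [← Real.exp_add]; congr 1; field_simp; ring

/-- `∫ (√(2πt)⁹)⁻¹ e^{−‖z‖²/(4t)} dz = √2⁹` (half-rate Gaussian against the full-rate normalisation). [folklore] -/
theorem integral_halfGauss {t : ℝ} (ht : 0 < t) :
    ∫ z : ZM, (Real.sqrt (2 * π * t) ^ 9)⁻¹ * Real.exp (-(1 / (4 * t)) * ‖z‖ ^ 2) = Real.sqrt 2 ^ 9 := by
  have hπ := Real.pi_pos
  have hb : 0 < 1 / (4 * t) := by positivity
  have hS : 0 < Real.sqrt (2 * π * t) ^ 9 := by positivity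
  have hcard : Fintype.card (Fin 3 × Fin 3) = 9 := by simp
  rw [integral_const_mul, GaussForm.integral_exp_neg_mul_sq_norm hb, hcard,
    show π / (1 / (4 * t)) = 2 * (2 * π * t) by field_simp; ring, Real.sqrt_mul (by norm_num : (0:ℝ) ≤ 2), mul_pow,
    mul_comm (Real.sqrt 2 ^ 9), ← mul_assoc, inv_mul_cancel₀ hS.ne', one_mul]

/-- Pointwise: `‖z‖² p_t(z) ≤ (3t/2) · (√(2πt)⁹)⁻¹ e^{−‖z‖²/(4t)}` (`u e^{−u/(4t)} ≤ 4t/e ≤ 3t/2`). [folklore] -/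
theorem normSq_mul_heatKer₀_le {t : ℝ} (ht : 0 < t) (z : ZM) :
    ‖z‖ ^ 2 * heatKer₀ t z ≤ 3 / 2 * t * ((Real.sqrt (2 * π * t) ^ 9)⁻¹ * Real.exp (-(1 / (4 * t)) * ‖z‖ ^ 2)) := by
  have ha : 0 < 1 / (4 * t) := by positivity
  have h1 : ‖z‖ ^ 2 * Real.exp (-(1 / (4 * t)) * ‖z‖ ^ 2) ≤ (Real.exp 1 * (1 / (4 * t)))⁻¹ := GaussForm.mul_exp_neg_le ha
  have he : (Real.exp 1 * (1 / (4 * t)))⁻¹ ≤ 3 / 2 * t := by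
    have hexp : (8 : ℝ) / 3 ≤ Real.exp 1 := by have := Real.exp_one_gt_d9; linarith
    rw [mul_one_div, inv_div]
    rw [div_le_iff₀ (by positivity)]
    nlinarith
  rw [heatKer₀, exp_neg_normSq_div_eq ht]
  have hS : 0 < (Real.sqrt (2 * π * t) ^ 9)⁻¹ := by positivity
  have hE : 0 < Real.exp (-(1 / (4 * t)) * ‖z‖ ^ 2) := Real.exp_pos _
  calc ‖z‖ ^ 2 * ((Real.sqrt (2 * π * t) ^ 9)⁻¹ * (Real.exp (-(1 / (4 * t)) * ‖z‖ ^ 2) * Real.exp (-(1 / (4 * t)) * ‖z‖ ^ 2)))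
      = (‖z‖ ^ 2 * Real.exp (-(1 / (4 * t)) * ‖z‖ ^ 2)) * ((Real.sqrt (2 * π * t) ^ 9)⁻¹ * Real.exp (-(1 / (4 * t)) * ‖z‖ ^ 2)) := by
        ring
    _ ≤ (3 / 2 * t) * ((Real.sqrt (2 * π * t) ^ 9)⁻¹ * Real.exp (-(1 / (4 * t)) * ‖z‖ ^ 2)) :=
        mul_le_mul_of_nonneg_right (h1.trans he) (by positivity)

/-- Pointwise: `‖z‖⁴ p_t(z) ≤ 9t² · (√(2πt)⁹)⁻¹ e^{−‖z‖²/(4t)}` (`u e^{−u/(8t)} ≤ 8t/e ≤ 3t`, squared). [folklore] -/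
theorem norm_pow_four_mul_heatKer₀_le {t : ℝ} (ht : 0 < t) (z : ZM) :
    ‖z‖ ^ 4 * heatKer₀ t z ≤ 9 * t ^ 2 * ((Real.sqrt (2 * π * t) ^ 9)⁻¹ * Real.exp (-(1 / (4 * t)) * ‖z‖ ^ 2)) := by
  have ha : 0 < 1 / (8 * t) := by positivity
  have h1 : ‖z‖ ^ 2 * Real.exp (-(1 / (8 * t)) * ‖z‖ ^ 2) ≤ (Real.exp 1 * (1 / (8 * t)))⁻¹ := GaussForm.mul_exp_neg_le ha
  have he : (Real.exp 1 * (1 / (8 * t)))⁻¹ ≤ 3 * t := by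
    have hexp : (8 : ℝ) / 3 ≤ Real.exp 1 := by have := Real.exp_one_gt_d9; linarith
    rw [mul_one_div, inv_div, div_le_iff₀ (by positivity)]
    nlinarith
  have h0 : 0 ≤ ‖z‖ ^ 2 * Real.exp (-(1 / (8 * t)) * ‖z‖ ^ 2) := by positivity
  have hsq : (‖z‖ ^ 2 * Real.exp (-(1 / (8 * t)) * ‖z‖ ^ 2)) ^ 2 ≤ (3 * t) ^ 2 := pow_le_pow_left₀ h0 (h1.trans he) 2
  have e4 : ‖z‖ ^ 4 * Real.exp (-(1 / (4 * t)) * ‖z‖ ^ 2) = (‖z‖ ^ 2 * Real.exp (-(1 / (8 * t)) * ‖z‖ ^ 2)) ^ 2 := by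
    rw [mul_pow, ← Real.exp_nat_mul]
    congr 1
    · ring
    · congr 1; field_simp; ring
  rw [heatKer₀, exp_neg_normSq_div_eq ht]
  calc ‖z‖ ^ 4 * ((Real.sqrt (2 * π * t) ^ 9)⁻¹ * (Real.exp (-(1 / (4 * t)) * ‖z‖ ^ 2) * Real.exp (-(1 / (4 * t)) * ‖z‖ ^ 2)))
      = (‖z‖ ^ 4 * Real.exp (-(1 / (4 * t)) * ‖z‖ ^ 2)) * ((Real.sqrt (2 * π * t) ^ 9)⁻¹ * Real.exp (-(1 / (4 * t)) * ‖z‖ ^ 2)) := by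
        ring
    _ ≤ (9 * t ^ 2) * ((Real.sqrt (2 * π * t) ^ 9)⁻¹ * Real.exp (-(1 / (4 * t)) * ‖z‖ ^ 2)) := by
        rw [e4]
        refine mul_le_mul_of_nonneg_right (hsq.trans (le_of_eq (by ring))) (by positivity)

/-- The half-rate Gaussian (with the full-rate constant) is integrable. [folklore] -/
theorem integrable_halfGauss {t : ℝ} (ht : 0 < t) :
    Integrable fun z : ZM => (Real.sqrt (2 * π * t) ^ 9)⁻¹ * Real.exp (-(1 / (4 * t)) * ‖z‖ ^ 2) :=
  (GaussForm.integrable_gauss (ι := Fin 3 × Fin 3) (by positivity : 0 < 1 / (4 * t))).const_mul _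

/-- `‖z‖² p_t` is integrable (`t > 0`). [folklore] -/
theorem integrable_normSq_mul_heatKer₀ {t : ℝ} (ht : 0 < t) : Integrable fun z : ZM => ‖z‖ ^ 2 * heatKer₀ t z := by
  refine ((integrable_halfGauss ht).const_mul (3 / 2 * t)).mono'
    ((continuous_norm.pow 2).mul (continuous_heatKer₀ t)).aestronglyMeasurable (ae_of_all _ fun z => ?_)
  rw [Real.norm_eq_abs, abs_of_nonneg (mul_nonneg (sq_nonneg _) (heatKer₀_nonneg t z))]
  exact normSq_mul_heatKer₀_le ht z

/-- `‖z‖⁴ p_t` is integrable (`t > 0`). [folklore] -/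
theorem integrable_norm_pow_four_mul_heatKer₀ {t : ℝ} (ht : 0 < t) : Integrable fun z : ZM => ‖z‖ ^ 4 * heatKer₀ t z := by
  refine ((integrable_halfGauss ht).const_mul (9 * t ^ 2)).mono'
    ((continuous_norm.pow 4).mul (continuous_heatKer₀ t)).aestronglyMeasurable (ae_of_all _ fun z => ?_)
  rw [Real.norm_eq_abs, abs_of_nonneg (mul_nonneg (by positivity) (heatKer₀_nonneg t z))]
  exact norm_pow_four_mul_heatKer₀_le ht z

/-- **Second moment bound**: `∫ ‖z‖² p_t(z) dz ≤ 35 t`. [folklore] -/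
theorem integral_normSq_mul_heatKer₀_le {t : ℝ} (ht : 0 < t) : ∫ z : ZM, ‖z‖ ^ 2 * heatKer₀ t z ≤ 35 * t := by
  calc ∫ z : ZM, ‖z‖ ^ 2 * heatKer₀ t z
      ≤ ∫ z : ZM, 3 / 2 * t * ((Real.sqrt (2 * π * t) ^ 9)⁻¹ * Real.exp (-(1 / (4 * t)) * ‖z‖ ^ 2)) :=
        integral_mono (integrable_normSq_mul_heatKer₀ ht) ((integrable_halfGauss ht).const_mul _)
          fun z => normSq_mul_heatKer₀_le ht z
    _ = 3 / 2 * t * Real.sqrt 2 ^ 9 := by rw [integral_const_mul, integral_halfGauss ht]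
    _ ≤ 35 * t := by nlinarith [sqrt_two_pow_nine_le]

/-- **Fourth moment bound**: `∫ ‖z‖⁴ p_t(z) dz ≤ 210 t²`. [folklore] -/
theorem integral_norm_pow_four_mul_heatKer₀_le {t : ℝ} (ht : 0 < t) : ∫ z : ZM, ‖z‖ ^ 4 * heatKer₀ t z ≤ 210 * t ^ 2 := by
  calc ∫ z : ZM, ‖z‖ ^ 4 * heatKer₀ t z
      ≤ ∫ z : ZM, 9 * t ^ 2 * ((Real.sqrt (2 * π * t) ^ 9)⁻¹ * Real.exp (-(1 / (4 * t)) * ‖z‖ ^ 2)) :=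
        integral_mono (integrable_norm_pow_four_mul_heatKer₀ ht) ((integrable_halfGauss ht).const_mul _)
          fun z => norm_pow_four_mul_heatKer₀_le ht z
    _ = 9 * t ^ 2 * Real.sqrt 2 ^ 9 := by rw [integral_const_mul, integral_halfGauss ht]
    _ ≤ 210 * t ^ 2 := by nlinarith [sqrt_two_pow_nine_le, sq_nonneg t]

end Summit.QuantumFields.YangMills.Theorems.FemtoTransferGap

end
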